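import Mathlib
import Literature.RingTheory.CohomologyAnnihilator.BranchedCover
import Literature.RingTheory.CohomologyAnnihilator.Localization
import Literature.AlgebraicGeometry.Resolution.MvPowerSeriesNested
import Literature.AlgebraicGeometry.Resolution.PowerSeriesRegularLocal
import Summits.ResolutionOfSingularities.ResolutionOfSingularities.Theorems.HomologicalConductorPersistenceJacobianKept
import HarnessLib

/-!
# `ca` of a double branched cover: `ca(R♯) = π⁻¹(ca(R))` (W4.4b «F-DP», the double-point corollary)

Route `ResolutionOfSingularities/HomologicalConductor`, chain W4.4b (cell `res-hironaka`), crux `Persistence`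
(stmt-ResolutionOfSingularities-16484), §«cA arena» (res-L1-w44b-plan-1 CUT K-v13 2026-08-27T10:10:59Z, FACT-LIST §A
admission 10:27:28Z, CUT «F-DP» 10:27:47Z → res-type-011).  [OURS; AI-written, weaker than expert review; NOT a statement
of the manuscript under study (Hironaka 2017), and no statement of that manuscript is used.]

Vocabulary (tree, `Literature.RingTheory.CohomologyAnnihilator.BranchedCover`, p525400): for a commutative ring `S`,
`f ∈ S`, `m : ℕ`: `BranchedCover S f m = S⟦y⟧ ⧸ (C f + yᵐ)` (Esentepe's `R♯`, §5.1) and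
`branchedCoverProjection S f m : BranchedCover S f m →+* S ⧸ (f)` (`π`, `y ↦ 0`).  The NAMED FACT
`doubleBranchedCover_map_cohomologyAnnihilator_eq` [Esentepe2020, Thm. 5.4, `m = 2`]: for `S = k⟦x₁,…,xₙ⟧`, `char k ≠ 2`,
`0 ≠ f ∈ 𝔪_S`: `π(ca(R♯)) = ca(R)`.  This file PROVES, from that fact taken as a hypothesis:

* plumbing for `π`: `branchedCoverProjection_mk`, `branchedCoverProjection_surjective`,
  `ker_branchedCoverProjection : ker π = (ȳ)` (any `S`, `m ≠ 0`);
* `isRegularLocalRing_powerSeries_mvPowerSeries` — `k⟦x₁,…,xₙ⟧⟦y⟧` is a regular local ring of Krull dimension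
  `n + 1` (tree: `nestedEquiv` + `isRegularLocalRing_mvPowerSeries` / `ringKrullDim_mvPowerSeries`);
* `mk_X_mem_cohomologyAnnihilatorOfDegree` — **`ȳ ∈ caⁿ⁺¹(R♯)`** for the double cover in `char k ≠ 2`: the Jacobian
  mechanism `∂(f + y²)/∂y = 2y` of the source's proof, IN THE KERNEL via res-D-pv-058's
  `PersistenceJacobianKept.derivation_mem_cohomologyAnnihilatorOfDegree_of_isRegularLocalRing` (p522421) applied to
  `d/dy` on `S⟦y⟧` — no use of the named fact;
* **`cohomologyAnnihilator_doubleBranchedCover_eq_comap`** — from the named fact: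
  `ca(R♯) = (ca(R)).comap π` (⊆: `I ≤ π⁻¹π(I)`; ⊇: `π` surjective, `ker π = (ȳ) ⊆ ca(R♯)`), and the form
  `ca(R♯) = (ȳ) ⊔ (ca(R)).comap π` (`cohomologyAnnihilator_doubleBranchedCover_eq_span_sup_comap`).

This is ONE STEP of the cA-arena enabling formula `ca(k⟦x,y,z,t⟧/(xy − h)) = (x, y) + ca(k⟦z,t⟧/(h))·(…)`
(tri-1 REFEREE-cA-formula.md 021e37118be5ef45): `xy − h ~ u² + v² − h` (`char ≠ 2`, `√−1 ∈ k`) is a double cover of a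
double cover of the plane curve `C_h`; the second step needs the named fact transported along
`k⟦z,t⟧⟦u⟧ ≅ k⟦z,t,u⟧` (follow-up).  Filed `--supports stmt-ResolutionOfSingularities-16484 --as helper`.

References: Ö. Esentepe, J. Algebra 541 (2020), arXiv:1807.05471, Thm. 5.4 [`Esentepe2020`] (named fact, hypothesis);
S. B. Iyengar, R. Takahashi, IMRN 2016, Def. 2.1 [`IyengarTakahashi2014`].
-/

noncomputable section

-- single-problem summit: the doubled namespace component `ResolutionOfSingularities` is forced
set_option linter.dupNamespace false

namespace Summit.ResolutionOfSingularities.ResolutionOfSingularities.Theorems.HomologicalConductor.PersistenceBranchedCover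

open PowerSeries Literature.RingTheory.CohomologyAnnihilator Literature.AlgebraicGeometry.Resolution
open Summit.ResolutionOfSingularities.ResolutionOfSingularities.Theorems.HomologicalConductor.PersistenceJacobianKept

universe u

variable {S : Type u} [CommRing S]

/-! ## Plumbing for the projection `π : R♯ → R` -/

/-- `π` on classes: `π (mk a) = mk (constantCoeff a)`. [folklore] -/
theorem branchedCoverProjection_mk (f : S) (m : ℕ) [NeZero m] (a : PowerSeries S) :
    branchedCoverProjection S f m (Ideal.Quotient.mk _ a) =
      Ideal.Quotient.mk (Ideal.span {f}) (constantCoeff a) :=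
  rfl

/-- `π (ȳ) = 0`. [folklore] -/
theorem branchedCoverProjection_mk_X (f : S) (m : ℕ) [NeZero m] :
    branchedCoverProjection S f m (Ideal.Quotient.mk _ X) = 0 := by
  rw [branchedCoverProjection_mk, constantCoeff_X, map_zero]

/-- `π (mk (C s)) = mk s`. [folklore] -/
theorem branchedCoverProjection_mk_C (f : S) (m : ℕ) [NeZero m] (s : S) :
    branchedCoverProjection S f m (Ideal.Quotient.mk _ (C s)) = Ideal.Quotient.mk (Ideal.span {f}) s := by
  rw [branchedCoverProjection_mk, constantCoeff_C]

/-- `π` is surjective («the natural surjection», [Esentepe2020, §5.1]). [folklore] -/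
theorem branchedCoverProjection_surjective (f : S) (m : ℕ) [NeZero m] :
    Function.Surjective (branchedCoverProjection S f m) := by
  intro r
  obtain ⟨s, rfl⟩ := Ideal.Quotient.mk_surjective r
  exact ⟨Ideal.Quotient.mk _ (C s), branchedCoverProjection_mk_C f m s⟩

/-- **`ker π = (ȳ)`**: `R ≅ R♯ ⧸ (y)` [Esentepe2020, §5.1].  If `constantCoeff a ∈ (f)`, say `= b·f`, then
`a − C b·(C f + yᵐ)` has zero constant coefficient, hence is divisible by `y` (`PowerSeries.X_dvd_iff`).
[folklore] -/
theorem ker_branchedCoverProjection (f : S) (m : ℕ) [NeZero m] :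
    RingHom.ker (branchedCoverProjection S f m) =
      Ideal.span {Ideal.Quotient.mk (Ideal.span {(C f + X ^ m : PowerSeries S)}) X} := by
  apply le_antisymm
  · intro z hz
    obtain ⟨a, rfl⟩ := Ideal.Quotient.mk_surjective z
    rw [RingHom.mem_ker, branchedCoverProjection_mk, Ideal.Quotient.eq_zero_iff_mem,
      Ideal.mem_span_singleton'] at hz
    obtain ⟨b, hb⟩ := hz
    have h0 : constantCoeff (a - C b * (C f + X ^ m)) = 0 := by
      rw [map_sub, map_mul, constantCoeff_C, map_add, map_pow, constantCoeff_C, constantCoeff_X,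
        zero_pow (NeZero.ne m), add_zero, hb, sub_self]
    obtain ⟨c, hc⟩ := X_dvd_iff.mpr h0
    have hac : Ideal.Quotient.mk (Ideal.span {(C f + X ^ m : PowerSeries S)}) a =
        Ideal.Quotient.mk _ X * Ideal.Quotient.mk _ c := by
      rw [← map_mul, Ideal.Quotient.eq, ← hc, sub_sub_cancel]
      exact Ideal.mul_mem_left _ _ (Ideal.mem_span_singleton_self _)
    rw [hac]
    exact Ideal.mul_mem_right _ _ (Ideal.mem_span_singleton_self _)
  · rw [Ideal.span_le, Set.singleton_subset_iff, SetLike.mem_coe, RingHom.mem_ker]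
    exact branchedCoverProjection_mk_X f m

/-! ## `k⟦x₁,…,xₙ⟧⟦y⟧` is a regular local ring of dimension `n + 1` -/

/-- `S⟦y⟧ = PowerSeries (MvPowerSeries (Fin n) k)` is a regular local ring of Krull dimension `n + 1`: it is
`MvPowerSeries (Unit ⊕ Fin n) k` up to the ring isomorphism `nestedEquiv` (tree `MvPowerSeriesNested`), and power
series rings over a field in finitely many variables are regular local of dimension the number of variables (tree
`PowerSeriesRegularLocal`). [folklore] -/
theorem isRegularLocalRing_powerSeries_mvPowerSeries (k : Type u) [Field k] (n : ℕ) :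
    IsRegularLocalRing (PowerSeries (MvPowerSeries (Fin n) k)) ∧
      ringKrullDim (PowerSeries (MvPowerSeries (Fin n) k)) = (n + 1 : ℕ) := by
  let e : MvPowerSeries (Unit ⊕ Fin n) k ≃+* PowerSeries (MvPowerSeries (Fin n) k) :=
    MvPowerSeriesNested.nestedEquiv Unit (Fin n) k
  haveI := isRegularLocalRing_mvPowerSeries k (Unit ⊕ Fin n)
  refine ⟨IsRegularLocalRing.of_ringEquiv e, ?_⟩
  rw [← ringKrullDim_eq_of_ringEquiv e, ringKrullDim_mvPowerSeries, Nat.card_sum, Nat.card_unique,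
    Nat.card_eq_fintype_card, Fintype.card_fin, add_comm]

/-! ## `ȳ ∈ ca(R♯)` for the double cover (the Jacobian mechanism, in the kernel) -/

/-- The generator `C f + y²` is not a zero divisor of `S⟦y⟧` when `S` is a domain (it is non-zero: its `y²`-coefficient
is `1`). [folklore] -/
theorem generator_mem_nonZeroDivisors [IsDomain S] (f : S) :
    (C f + X ^ 2 : PowerSeries S) ∈ nonZeroDivisors (PowerSeries S) := by
  apply mem_nonZeroDivisors_of_ne_zero
  intro h
  have h2 := congrArg (coeff 2) h
  rw [map_add, coeff_C, if_neg (by norm_num), coeff_X_pow, if_pos rfl, zero_add, map_zero] at h2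
  exact one_ne_zero h2

/-- `d/dy (C f + y²) = 2y`. [folklore] -/
theorem derivative_generator (f : S) : derivative S (C f + X ^ 2 : PowerSeries S) = 2 * X := by
  rw [map_add, derivative_C, zero_add, Derivation.leibniz_pow, derivative_X, pow_one, smul_eq_mul, mul_one,
    nsmul_eq_mul, Nat.cast_ofNat]

/-- **`ȳ ∈ caⁿ⁺¹(R♯)`** for the double branched cover `R♯ = S⟦y⟧ ⧸ (f + y²)`, `S = k⟦x₁,…,xₙ⟧`, `char k ≠ 2` — the
step «`d/dy (f + y²) = 2y`, so `y ∈ J_{R♯} ⊆ ca(R♯)`» of [Esentepe2020, proof of Thm. 5.4], here PROVED: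
res-D-pv-058's `derivation_mem_cohomologyAnnihilatorOfDegree_of_isRegularLocalRing` (p522421) for the derivation `d/dy`
of the regular local ring `S⟦y⟧` of dimension `n + 1` gives `(2y)‾ ∈ caⁿ⁺¹(R♯)`, and `2` is a unit. [folklore] -/
theorem mk_X_mem_cohomologyAnnihilatorOfDegree (k : Type u) [Field k] (hchar : ringChar k ≠ 2) (n : ℕ)
    (f : MvPowerSeries (Fin n) k) :
    Ideal.Quotient.mk (Ideal.span {(C f + X ^ 2 : PowerSeries (MvPowerSeries (Fin n) k))}) X ∈
      cohomologyAnnihilatorOfDegree (BranchedCover (MvPowerSeries (Fin n) k) f 2) (n + 1) := by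
  obtain ⟨hreg, hdim⟩ := isRegularLocalRing_powerSeries_mvPowerSeries k n
  haveI := hreg
  haveI : IsDomain (MvPowerSeries (Fin n) k) := NoZeroDivisors.to_isDomain _
  have h := derivation_mem_cohomologyAnnihilatorOfDegree_of_isRegularLocalRing (d := n) hdim
    (C f + X ^ 2 : PowerSeries (MvPowerSeries (Fin n) k)) (generator_mem_nonZeroDivisors f)
    (derivative (MvPowerSeries (Fin n) k))
  rw [derivative_generator, map_mul, map_ofNat] at h
  have h2 : IsUnit (2 : BranchedCover (MvPowerSeries (Fin n) k) f 2) := by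
    have h2k : IsUnit (2 : k) := (Ring.two_ne_zero hchar).isUnit
    have h2R := h2k.map (algebraMap k (BranchedCover (MvPowerSeries (Fin n) k) f 2))
    rwa [map_ofNat] at h2R
  exact (Ideal.unit_mul_mem_iff_mem _ h2).mp h

/-- `ȳ ∈ ca(R♯)` (level-free form). [folklore] -/
theorem mk_X_mem_cohomologyAnnihilator (k : Type u) [Field k] (hchar : ringChar k ≠ 2) (n : ℕ)
    (f : MvPowerSeries (Fin n) k) :
    Ideal.Quotient.mk (Ideal.span {(C f + X ^ 2 : PowerSeries (MvPowerSeries (Fin n) k))}) X ∈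
      cohomologyAnnihilator (BranchedCover (MvPowerSeries (Fin n) k) f 2) :=
  cohomologyAnnihilatorOfDegree_le (n + 1) (mk_X_mem_cohomologyAnnihilatorOfDegree k hchar n f)

/-! ## The corollary: `ca(R♯) = π⁻¹(ca(R))` -/

/-- **`ca(R♯) = π⁻¹(ca(R))` for the double branched cover** `R♯ = S⟦y⟧ ⧸ (f + y²) → R = S ⧸ (f)`, `S = k⟦x₁,…,xₙ⟧`,
`char k ≠ 2`, `0 ≠ f ∈ 𝔪_S` — PROVED modulo the named fact [Esentepe2020, Thm. 5.4, `m = 2`]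
(`doubleBranchedCover_map_cohomologyAnnihilator_eq`: `π(ca(R♯)) = ca(R)`): `⊆` is `I ≤ π⁻¹(π(I))`; for `⊇`, if
`π z ∈ ca(R) = π(ca(R♯))` pick `w ∈ ca(R♯)` with `π w = π z`; then `z − w ∈ ker π = (ȳ) ⊆ ca(R♯)`
(`ker_branchedCoverProjection`, `mk_X_mem_cohomologyAnnihilator`). [cite: Esentepe2020, Theorem 5.4 (consequence)] -/
theorem cohomologyAnnihilator_doubleBranchedCover_eq_comap
    (hE : doubleBranchedCover_map_cohomologyAnnihilator_eq.{u}) (k : Type u) [Field k]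
    (hchar : ringChar k ≠ 2) (n : ℕ) (f : MvPowerSeries (Fin n) k) (hf : MvPowerSeries.constantCoeff f = 0)
    (hf0 : f ≠ 0) :
    cohomologyAnnihilator (BranchedCover (MvPowerSeries (Fin n) k) f 2) =
      (cohomologyAnnihilator (MvPowerSeries (Fin n) k ⧸ Ideal.span {f})).comap
        (branchedCoverProjection (MvPowerSeries (Fin n) k) f 2) := by
  have hmap := hE k hchar n f hf hf0
  apply le_antisymm
  · rw [← hmap]
    exact Ideal.le_comap_map
  · intro z hz
    rw [Ideal.mem_comap, ← hmap] at hz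
    obtain ⟨w, hw, hwz⟩ :=
      (Ideal.mem_map_iff_of_surjective _ (branchedCoverProjection_surjective f 2)).mp hz
    have hker : z - w ∈ RingHom.ker (branchedCoverProjection (MvPowerSeries (Fin n) k) f 2) := by
      rw [RingHom.mem_ker, map_sub, hwz, sub_self]
    rw [ker_branchedCoverProjection, Ideal.mem_span_singleton'] at hker
    obtain ⟨c, hc⟩ := hker
    have hzw : z - w ∈ cohomologyAnnihilator (BranchedCover (MvPowerSeries (Fin n) k) f 2) := by
      rw [← hc]
      exact Ideal.mul_mem_left _ _ (mk_X_mem_cohomologyAnnihilator k hchar n f)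
    have := Ideal.add_mem _ hzw hw
    rwa [sub_add_cancel] at this

/-- The same in the form **`ca(R♯) = (ȳ) ⊔ π⁻¹(ca(R))`** («`ca(R♯) = (y) + ca(R)·R♯`» of the cA-arena memo; the span is
contained in the comap, `π ȳ = 0`). [cite: Esentepe2020, Theorem 5.4 (consequence)] -/
theorem cohomologyAnnihilator_doubleBranchedCover_eq_span_sup_comap
    (hE : doubleBranchedCover_map_cohomologyAnnihilator_eq.{u}) (k : Type u) [Field k]
    (hchar : ringChar k ≠ 2) (n : ℕ) (f : MvPowerSeries (Fin n) k) (hf : MvPowerSeries.constantCoeff f = 0)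
    (hf0 : f ≠ 0) :
    cohomologyAnnihilator (BranchedCover (MvPowerSeries (Fin n) k) f 2) =
      Ideal.span {Ideal.Quotient.mk _ X} ⊔
        (cohomologyAnnihilator (MvPowerSeries (Fin n) k ⧸ Ideal.span {f})).comap
          (branchedCoverProjection (MvPowerSeries (Fin n) k) f 2) := by
  rw [cohomologyAnnihilator_doubleBranchedCover_eq_comap hE k hchar n f hf hf0, eq_comm, sup_eq_right,
    Ideal.span_le, Set.singleton_subset_iff, SetLike.mem_coe, Ideal.mem_comap, branchedCoverProjection_mk_X]
  exact Ideal.zero_mem _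

/-- **Every element of `ca(R)` lifts into `ca(R♯)`**: for `s ∈ S` with `s̄ ∈ ca(S ⧸ (f))`, the class of `C s` lies in
`ca(R♯)` (immediate from the comap form). [cite: Esentepe2020, Theorem 5.4 (consequence)] -/
theorem mk_C_mem_cohomologyAnnihilator_of_mem
    (hE : doubleBranchedCover_map_cohomologyAnnihilator_eq.{u}) (k : Type u) [Field k]
    (hchar : ringChar k ≠ 2) (n : ℕ) (f : MvPowerSeries (Fin n) k) (hf : MvPowerSeries.constantCoeff f = 0)
    (hf0 : f ≠ 0) {s : MvPowerSeries (Fin n) k}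
    (hs : Ideal.Quotient.mk (Ideal.span {f}) s ∈ cohomologyAnnihilator (MvPowerSeries (Fin n) k ⧸ Ideal.span {f})) :
    Ideal.Quotient.mk (Ideal.span {(C f + X ^ 2 : PowerSeries (MvPowerSeries (Fin n) k))}) (C s) ∈
      cohomologyAnnihilator (BranchedCover (MvPowerSeries (Fin n) k) f 2) := by
  rw [cohomologyAnnihilator_doubleBranchedCover_eq_comap hE k hchar n f hf hf0, Ideal.mem_comap]
  change branchedCoverProjection _ f 2 (Ideal.Quotient.mk _ (C s)) ∈ _
  rwa [branchedCoverProjection_mk_C]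

end Summit.ResolutionOfSingularities.ResolutionOfSingularities.Theorems.HomologicalConductor.PersistenceBranchedCover

end
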